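import Literature.AlgebraicGeometry.KTheory.CoherentGrothendieckGroupRankUnit
import Literature.AlgebraicGeometry.Modules.RankOneCocycle
import Literature.AlgebraicGeometry.Modules.FrameTransition
import HarnessLib

/-!
# The stalk of a vector bundle is free on the germs of a frame; `rank [E] = r` for a vector bundle of rank `r`

Layer `Literature/AlgebraicGeometry/KTheory` with a `Modules`-level §1 (0 definitions, 0 named facts, no instances, no
notation). Hartshorne II.5 (p. 109) / Ex. 5.7 (a): for a locally free `𝒪_X`-module of finite rank the stalks `E_x` are
free `𝒪_{X,x}`-modules of the same rank; Ex. 6.10 (b): the rank of a coherent sheaf on an integral scheme is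
`dim_K 𝓕_ξ`, so a locally free sheaf of rank `r` has rank `r`.

* §1 (`Modules`, any scheme, any point) **the germs of the basis sections of a frame `e : 𝒪^I_W ≅ E|_W` at a point
  `x ∈ W` form a basis of the `𝒪_{X,x}`-module `E_x`** (`Modules/SkyscraperModule.stalkFunctor`):
  `nonempty_basis_stalk_of_frame` — spanning by the frame expansion `s = Σ λᵢ(s) bᵢ|_V`
  (`Modules/LocalFrames.eq_sum_coord_smul`), independence because a relation `Σ cᵢ • germ bᵢ = 0` with
  `cᵢ = germ aᵢ` descends to `Σ aᵢ bᵢ|_V = 0` on a neighbourhood, where coordinates are unique; hence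
  `finrank_stalk_eq_card_of_frame` and `finrank_stalk_eq_of_hasRank` (**`dim_{𝒪_{X,x}} E_x = r` for `E` of rank `r`**,
  through the tree's frame systems `Modules/RankOneCocycle.exists_frameSystem_of_hasRank`);
* §2 (`KTheory`, `X` integral) **`KZeroCoh.genericRank_of_eq_of_hasRank : rank [E] = r`** and
  `genericRank_toKZeroCoh_of_eq_of_hasRank : rank (ε[E]) = r` for a vector bundle `E` of rank `r`
  (`KTheory/CoherentGrothendieckGroupRank.genericRank`).

## References

* R. Hartshorne, *Algebraic Geometry*, GTM 52 (1977), II.5 (p. 109), II Ex. 5.7 (a) (p. 124), II Ex. 6.10 (b) (p. 148). [Hartshorne1977]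
* U. Görtz, T. Wedhorn, *Algebraic Geometry I*, 2nd ed. (2020), (7.8.6), Prop. 7.41. [GortzWedhorn2020]
-/

noncomputable section

-- `TopCat.Presheaf`/`Scheme.Modules` are not reducible (as in Mathlib's `AlgebraicGeometry/Modules`).
set_option backward.isDefEq.respectTransparency false

universe u

open CategoryTheory CategoryTheory.Limits AlgebraicGeometry TopologicalSpace Opposite

namespace Literature.AlgebraicGeometry.Modules

open Literature.AlgebraicGeometry.Motives Literature.AlgebraicGeometry.Morphisms

variable {X : Scheme.{u}} (x : X) {E : X.Modules} {W : X.Opens} {I : Type u}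

/-! ## §1 The stalk of a framed module is free on the germs of the frame -/

/-- Germs are additive over finite sums (the germ map is a group homomorphism). [cite: GortzWedhorn2020, (7.8.6)] -/
theorem stalkGerm_sum (M : X.Modules) (U : X.Opens) (hx : x ∈ U) {ι : Type*} (t : Finset ι) (f : ι → Γ(M, U)) :
    stalkGerm x M U hx (∑ i ∈ t, f i) = ∑ i ∈ t, stalkGerm x M U hx (f i) :=
  map_sum (ConcreteCategory.hom (M.presheaf.germ U x hx)) f t

/-- **A relation among restricted frame sections has zero coefficients**: `Σᵢ aᵢ • bᵢ|_V = 0 ⇒ aⱼ = 0`.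
[cite: GortzWedhorn2020, Prop. 7.41] -/
theorem eq_zero_of_sum_smul_basisSection_eq_zero [Fintype I] (e : SheafOfModules.free I ≅ E.over W) {V : X.Opens}
    (k : V ⟶ W) (a : I → Γ(X, V)) (h : ∑ i, a i • E.presheaf.map k.op (basisSection e i) = 0) (j : I) : a j = 0 := by
  rw [← coord_sum_smul_basisSection e k a j, h, coord_def, appLE_zero_right]

/-- **The germs at `x ∈ W` of the basis sections of a frame `𝒪^I_W ≅ E|_W` span `E_x`** (frame expansion of a
representative over `V ⊆ W`). [cite: Hartshorne1977, II.5 (p. 109)] [cite: GortzWedhorn2020, (7.8.6)] -/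
theorem span_stalkGerm_basisSection [Fintype I] (e : SheafOfModules.free I ≅ E.over W) (hx : x ∈ W) :
    Submodule.span (X.presheaf.stalk x) (Set.range fun i => stalkGerm x E W hx (basisSection e i)) = ⊤ := by
  rw [eq_top_iff]
  intro v _
  obtain ⟨V, hxV, s, rfl⟩ := exists_stalkGerm_eq x E v
  -- move to `V ⊓ W` and expand in the frame
  have hxVW : x ∈ V ⊓ W := Opens.mem_inf.mpr ⟨hxV, hx⟩
  let k : V ⊓ W ⟶ W := homOfLE inf_le_right
  have hs : stalkGerm x E V hxV s = stalkGerm x E (V ⊓ W) hxVW (E.presheaf.map (homOfLE inf_le_left).op s) :=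
    (TopCat.Presheaf.germ_res_apply E.presheaf (homOfLE inf_le_left) x hxVW s).symm
  rw [hs, eq_sum_coord_smul e k (E.presheaf.map (homOfLE inf_le_left).op s), stalkGerm_sum]
  refine Submodule.sum_mem _ fun i _ => ?_
  rw [stalkGerm_smul]
  refine Submodule.smul_mem _ _ ?_
  have hb : stalkGerm x E (V ⊓ W) hxVW (E.presheaf.map k.op (basisSection e i)) = stalkGerm x E W hx (basisSection e i) :=
    TopCat.Presheaf.germ_res_apply E.presheaf k x hxVW (basisSection e i)
  rw [hb]
  exact Submodule.subset_span ⟨i, rfl⟩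

/-- **The germs of the basis sections of a frame are linearly independent over `𝒪_{X,x}`**: a relation with germ
coefficients `germ aᵢ` descends to a neighbourhood, where the coefficients of the frame are unique.
[cite: Hartshorne1977, II.5 (p. 109)] [cite: GortzWedhorn2020, (7.8.6)] -/
theorem linearIndependent_stalkGerm_basisSection [Fintype I] (e : SheafOfModules.free I ≅ E.over W) (hx : x ∈ W) :
    LinearIndependent (X.presheaf.stalk x) (fun i => stalkGerm x E W hx (basisSection e i)) := by
  classical
  rw [Fintype.linearIndependent_iff]
  intro g hg
  -- representatives `aᵢ ∈ Γ(X, Vᵢ)` of the coefficients, on a common neighbourhood `V ⊆ W`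
  choose V hxV a ha using fun i => X.presheaf.exists_germ_eq (g i)
  let V₀ : X.Opens := W ⊓ ⨅ i, V i
  have hxV₀ : x ∈ V₀ := by
    refine ⟨hx, ?_⟩
    rw [Opens.coe_iInf]
    exact Set.mem_iInter.mpr hxV
  have hV₀W : V₀ ≤ W := inf_le_left
  have hV₀V : ∀ i, V₀ ≤ V i := fun i => inf_le_right.trans (iInf_le _ i)
  let k : V₀ ⟶ W := homOfLE hV₀W
  let a₀ : I → Γ(X, V₀) := fun i => X.presheaf.map (homOfLE (hV₀V i)).op (a i)
  have ha₀ : ∀ i, X.presheaf.germ V₀ x hxV₀ (a₀ i) = g i := fun i => by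
    rw [← ha i]; exact TopCat.Presheaf.germ_res_apply X.presheaf (homOfLE (hV₀V i)) x hxV₀ (a i)
  -- the relation holds for the germ of the section `Σ a₀ᵢ • bᵢ|_{V₀}`
  have hsum : stalkGerm x E V₀ hxV₀ (∑ i, a₀ i • E.presheaf.map k.op (basisSection e i)) = 0 := by
    rw [stalkGerm_sum, ← hg]
    refine Finset.sum_congr rfl fun i _ => ?_
    rw [stalkGerm_smul, ha₀ i]
    congr 1
    exact TopCat.Presheaf.germ_res_apply E.presheaf k x hxV₀ (basisSection e i)
  -- so the section vanishes on some `V₁ ⊆ V₀` around `x`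
  have h0 : E.presheaf.germ V₀ x hxV₀ (∑ i, a₀ i • E.presheaf.map k.op (basisSection e i)) =
      E.presheaf.germ V₀ x hxV₀ 0 := by rw [map_zero]; exact hsum
  obtain ⟨V₁, hxV₁, i₁, i₂, hres⟩ := TopCat.Presheaf.germ_eq E.presheaf x hxV₀ hxV₀ _ _ h0
  rw [map_zero] at hres
  -- restrict the relation to `V₁` and read off the coefficients
  have hrel : ∑ i, X.presheaf.map i₁.op (a₀ i) • E.presheaf.map (i₁ ≫ k).op (basisSection e i) = 0 := by
    rw [← hres, map_sum]
    refine Finset.sum_congr rfl fun i _ => ?_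
    rw [op_comp, E.presheaf.map_comp]
    exact (res_smul E i₁.le (a₀ i) (E.presheaf.map k.op (basisSection e i))).symm
  intro i
  have hai : X.presheaf.map i₁.op (a₀ i) = 0 := eq_zero_of_sum_smul_basisSection_eq_zero e (i₁ ≫ k) _ hrel i
  rw [← ha₀ i, ← TopCat.Presheaf.germ_res_apply X.presheaf i₁ x hxV₁ (a₀ i), hai, map_zero]

/-- **The stalk `E_x` of a framed module is free on the germs of the frame.** [cite: Hartshorne1977, II.5 (p. 109)] -/
theorem nonempty_basis_stalk_of_frame [Fintype I] (e : SheafOfModules.free I ≅ E.over W) (hx : x ∈ W) :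
    Nonempty (Module.Basis I (X.presheaf.stalk x) ((stalkFunctor x).obj E)) :=
  ⟨Module.Basis.mk (linearIndependent_stalkGerm_basisSection x e hx)
    (span_stalkGerm_basisSection x e hx).ge⟩

/-- **`dim_{𝒪_{X,x}} E_x = #I` for a frame `𝒪^I_W ≅ E|_W` around `x`.** [cite: Hartshorne1977, II Ex. 5.7 (a) (p. 124)] -/
theorem finrank_stalk_eq_card_of_frame [Fintype I] (e : SheafOfModules.free I ≅ E.over W) (hx : x ∈ W) :
    Module.finrank (X.presheaf.stalk x) ((stalkFunctor x).obj E) = Fintype.card I := by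
  obtain ⟨b⟩ := nonempty_basis_stalk_of_frame x e hx
  exact Module.finrank_eq_card_basis b

/-- **`dim_{𝒪_{X,x}} E_x = r` for a vector bundle `E` of rank `r`** (a frame of size `r` around every point,
`Modules/RankOneCocycle.exists_frameSystem_of_hasRank`). [cite: Hartshorne1977, II Ex. 5.7 (a) (p. 124)] -/
theorem finrank_stalk_eq_of_hasRank {r : ℕ} (hE : HasRank E r) :
    Module.finrank (X.presheaf.stalk x) ((stalkFunctor x).obj E) = r := by
  obtain ⟨F, hF⟩ := exists_frameSystem_of_hasRank hE
  haveI : Fintype (F.I x) := Fintype.ofEquiv _ (F.enum x).symm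
  rw [finrank_stalk_eq_card_of_frame x (F.frame x) (F.mem x), Fintype.card_congr (F.enum x), Fintype.card_fin, hF x]

end Literature.AlgebraicGeometry.Modules

namespace Literature.AlgebraicGeometry.KTheory

open Literature.AlgebraicGeometry.Motives Literature.AlgebraicGeometry.Morphisms Literature.AlgebraicGeometry.Modules
open Literature.AlgebraicGeometry.KTheory.Adapted (coh_of_isFiniteLocallyFree)

variable {X : Scheme.{u}} [IsIntegral X]

/-! ## §2 `rank [E] = r` for a vector bundle of rank `r` -/

/-- **`rank [E] = r` for a vector bundle `E` of rank `r`** on an integral scheme (Hartshorne II Ex. 6.10 (b): the rank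
`dim_K E_ξ` of a locally free sheaf of rank `r` is `r`). [cite: Hartshorne1977, II Ex. 6.10 (b) (p. 148)] -/
theorem KZeroCoh.genericRank_of_eq_of_hasRank {E : X.Modules} {r : ℕ} (hE : HasRank E r) (hE' : Coh E) :
    KZeroCoh.genericRank (KZeroCoh.of E hE') = r := by
  rw [KZeroCoh.genericRank_of, finrank_stalk_eq_of_hasRank (genericPoint X) hE]

/-- `rank (ε[E]) = r` for the `K₀(X)`-class of a vector bundle of rank `r`. [cite: Hartshorne1977, II Ex. 6.10 (b) (p. 148)] -/
theorem KZeroCoh.genericRank_toKZeroCoh_of_eq_of_hasRank {E : X.Modules} {r : ℕ} (hE : HasRank E r) :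
    KZeroCoh.genericRank (KZero.toKZeroCoh (KZero.of E hE.hasRankLE.isFiniteLocallyFree)) = r := by
  rw [KZero.toKZeroCoh_of _ _ (coh_of_isFiniteLocallyFree hE.hasRankLE.isFiniteLocallyFree),
    KZeroCoh.genericRank_of_eq_of_hasRank hE]

end Literature.AlgebraicGeometry.KTheory

end
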